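import Summits.Langlands.Langlands.Theses.NonParallelVoid
import Summits.Langlands.Langlands.Theorems.DyadicDihedralFM.Negative.IrreducibleRedundant

/-!
# `ResidueParallel` / line `inert-fl-transfer` (crux stmt-Langlands-17003): `hirr` is redundant in the
# regime `U` of stubs 1–3 as well — residual absolute irreducibility of `ρ|Γ_{F(ζ_p)}` forces `ρ` irreducible
# (negative-side support, refuter cdisprove seat; hypothesis-mutation finding, sorry-free)

Companion of `Negative/IrreducibleRedundant.lean` (which derives `hirr` from `¬hLR`).  The stubs
`stub_inductionUnramifiedFL`, `stub_tensorUnramifiedFL` of the picked line do not carry `¬hLR`, but their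
regime `U` contains `FramedGaloisRep.IsResiduallyAbsIrreducible (ρ.restrictField (CyclotomicField p F))`
(as does the crux's good regime `G`).  We record, kernel-checked:

* `isIrreducible_of_isIrreducible_restrictField` — if the restriction `ρ|Γ_L` of a framed Galois
  representation `ρ : Γ_K → GL_n(A)` (field coefficients) along `absGaloisRestrict K L` is irreducible,
  so is `ρ` (an invariant subspace for `Γ_K` is invariant for the image of `Γ_L`);
* `isIrreducible_of_isResiduallyAbsIrreducible_restrictField` — hence residual absolute irreducibility of
  `ρ|Γ_L` (any extension `L/K`, e.g. `L = K(ζ_p)`) forces irreducibility of `ρ : Γ_K → GL_n(ℚ̄_ℓ)`,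
  `n ≥ 1` (via the accepted `DyadicDihedralFM.Negative.isIrreducible_of_isResiduallyAbsIrreducible`,
  Burnside twice).

Moral for the lead of `inert-fl-transfer`: in all four stubs the binder `ρ.toGaloisRep.IsIrreducible` is
recoverable from the other hypotheses (stubs 3–4: `¬hLR`; stubs 1–3: `U.2.2.2.1`); no stub proof can use
`hirr` essentially.  This file does NOT refute anything.
-/

noncomputable section

set_option linter.dupNamespace false

namespace Summit.Langlands.Langlands.Theorems.ResidueParallel.Negative

open Literature.NumberTheory.GaloisRepresentations
open scoped MatrixGroups Matrix

/-- **Irreducible after restriction ⇒ irreducible.**  For `ρ : Γ_K → GL_n(A)` (`A` a field) and any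
field extension `L/K`: if `ρ|Γ_L = ρ ∘ absGaloisRestrict K L` is irreducible then `ρ` is irreducible. -/
theorem isIrreducible_of_isIrreducible_restrictField {K : Type*} [Field K] {A : Type*} [Field A]
    [TopologicalSpace A] [IsTopologicalRing A] {n : ℕ} (ρ : FramedGaloisRep K A n)
    (L : Type*) [Field L] [Algebra K L] (h : (ρ.restrictField L).toGaloisRep.IsIrreducible) :
    ρ.toGaloisRep.IsIrreducible := by
  show IsSimpleOrder (Subrepresentation ρ.toRepresentation)
  -- `h` is `IsSimpleOrder (Subrepresentation (ρ.restrictField L).toRepresentation)`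
  have hS : IsSimpleOrder (Subrepresentation (ρ.restrictField L).toRepresentation) := h
  -- every subrepresentation of `ρ` is one of `ρ|Γ_L`, with the same underlying submodule
  let T : Subrepresentation ρ.toRepresentation →
      Subrepresentation (ρ.restrictField L).toRepresentation := fun W =>
    ⟨W.toSubmodule, fun g v hv => by
      simpa [FramedRep.toRepresentation_apply_apply] using
        W.apply_mem_toSubmodule (absGaloisRestrict K L g) hv⟩
  have hT : ∀ W, (T W).toSubmodule = W.toSubmodule := fun W => rfl
  -- non-triviality transfers (same lattice of submodules underneath)
  have hnt : Nontrivial (Subrepresentation ρ.toRepresentation) := by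
    obtain ⟨x, y, hxy⟩ := hS.toNontrivial
    have hV : Nontrivial (Submodule A (Fin n → A)) :=
      ⟨⟨x.toSubmodule, y.toSubmodule, fun e => hxy (Subrepresentation.toSubmodule_injective e)⟩⟩
    refine ⟨⟨⊥, ⊤, fun e => ?_⟩⟩
    exact bot_ne_top (congrArg Subrepresentation.toSubmodule e)
  haveI := hnt
  refine IsSimpleOrder.mk fun W => ?_
  rcases hS.eq_bot_or_eq_top (T W) with e | e
  · left
    apply Subrepresentation.toSubmodule_injective
    rw [← hT W, e]; rfl
  · right
    apply Subrepresentation.toSubmodule_injective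
    rw [← hT W, e]; rfl

/-- **Residually absolutely irreducible after restriction ⇒ irreducible** (`n ≥ 1`, coefficients
`ℚ̄_ℓ`): if `ρ|Γ_L` is residually absolutely irreducible (e.g. `L = K(ζ_p)`, the clause of the regimes
`G` / `U` of route `NonParallelVoid`) then `ρ : Γ_K → GL_n(ℚ̄_ℓ)` is irreducible. -/
theorem isIrreducible_of_isResiduallyAbsIrreducible_restrictField {K : Type*} [Field K] {ℓ : ℕ}
    [Fact ℓ.Prime] {n : ℕ} (hn : 0 < n) (ρ : FramedGaloisRep K (PadicAlgCl ℓ) n)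
    (L : Type*) [Field L] [Algebra K L]
    (h : FramedGaloisRep.IsResiduallyAbsIrreducible (ρ.restrictField L)) :
    ρ.toGaloisRep.IsIrreducible :=
  isIrreducible_of_isIrreducible_restrictField ρ L
    (Summit.Langlands.Langlands.Theorems.DyadicDihedralFM.Negative.isIrreducible_of_isResiduallyAbsIrreducible
      hn _ h)

/-- **Specialisation to the crux's shape**: for `ρ : Γ_F → GL₂(ℚ̄_p)` over a number field, the clause
`IsResiduallyAbsIrreducible (ρ.restrictField (CyclotomicField p F))` of the regimes `G` (crux) and `U`
(stubs 1–3 of line `inert-fl-transfer`) forces `ρ.toGaloisRep.IsIrreducible`. -/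
theorem isIrreducible_of_isResiduallyAbsIrreducible_cyclotomic {F : Type} [Field F] [NumberField F]
    {p : ℕ} [Fact p.Prime] (ρ : FramedGaloisRep F (PadicAlgCl p) 2)
    (h : FramedGaloisRep.IsResiduallyAbsIrreducible (ρ.restrictField (CyclotomicField p F))) :
    ρ.toGaloisRep.IsIrreducible :=
  isIrreducible_of_isResiduallyAbsIrreducible_restrictField two_pos ρ (CyclotomicField p F) h

end Summit.Langlands.Langlands.Theorems.ResidueParallel.Negative

end
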